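import Literature.AlgebraicGeometry.Resolution.WeightedBlowupShade

/-!
# Sanity lemmas for the cobordant transform and the residual polynomial (pub-rosobs REVIEW-RUNBOOK,
# cards `WeightedBlowup.cobordantTransform`, `WeightedBlowup.residual`)

Review evidence only (ops-runbook sanity registry `registry/pub-rosobs.json`); no new definitions.
(`Literature/AlgebraicGeometry/Resolution/WeightedBlowupShade.lean`.)

* `cobordantExponent` on a monomial `u^d = u_i^n`: `u'_i^n · s^{w_i n − ℓ}` — the printed exponent law
  `u^d ↦ s^{Σ w_i d_i − ℓ} u'^d` of [AbramovichQuekSchober2025, Def. 4.5];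
* `cobordantTransform` is `0` on `0` and a single monomial on a monomial; worked instance: one centre
  variable of weight `1`, `ℓ = 2`: the proper transform of `u²` is `u'²` (the factor `s^{2−2}` is `1`);
* `residual w ℓ b F` has constant coefficient `0` — it vanishes at the point, so "`ord₀ residual ≥ q`"
  (`IsEquimultiplePoint`) is a condition on a genuine germ at the point; `residual … 0 = 0`.
-/

namespace Summit.ResolutionOfSingularities.KangarooAtlas.Runbook

open MvPolynomial Literature.AlgebraicGeometry.Resolution Literature.AlgebraicGeometry.Resolution.WeightedBlowup

variable {σ : Type*} {K : Type*} [CommRing K]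

/-- The exponent law on a pure power `u_i^n`: `u'_i^n s^{w_i n − ℓ}`. -/
theorem cobordantExponent_single (w : σ → ℕ) (ℓ : ℕ) (i : σ) (n : ℕ) :
    cobordantExponent w ℓ (Finsupp.single i n) =
      Finsupp.single (some i) n + Finsupp.single none (w i * n - ℓ) := by
  simp [cobordantExponent, Finsupp.mapDomain_single, Finsupp.sum_single_index]

/-- The cobordant transform of `0` is `0`. -/
theorem cobordantTransform_zero (w : σ → ℕ) (ℓ : ℕ) :
    cobordantTransform w ℓ (0 : MvPolynomial σ K) = 0 := by
  simp [cobordantTransform]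

/-- The cobordant transform of a monomial `c·u^d` (`c ≠ 0`) is the single monomial
`c · s^{Σ wᵢdᵢ − ℓ} u'^d`. -/
theorem cobordantTransform_monomial (w : σ → ℕ) (ℓ : ℕ) (d : σ →₀ ℕ) {c : K} (hc : c ≠ 0) :
    cobordantTransform w ℓ (monomial d c) = monomial (cobordantExponent w ℓ d) c := by
  classical
  rw [cobordantTransform, support_monomial, if_neg hc, Finset.sum_singleton, coeff_monomial, if_pos rfl]

/-- Worked instance: one centre variable `u` of weight `1`, `ℓ = 2` (the centre `(x², u²)`-type datum):
the proper transform of `u²` is `u'²` — exponent `single (some 0) 2`, no power of `s`. -/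
theorem cobordantTransform_X_sq [Nontrivial K] :
    cobordantTransform (fun _ : Fin 1 => 1) 2 (X 0 ^ 2 : MvPolynomial (Fin 1) K) =
      X (some 0) ^ 2 := by
  rw [X_pow_eq_monomial, cobordantTransform_monomial _ _ _ one_ne_zero, cobordantExponent_single,
    X_pow_eq_monomial]
  norm_num

/-- Worked instance with a surviving power of `s`: weight `1`, `ℓ = 2`, the monomial `u³` transforms to
`s · u'³` (`3·1 − 2 = 1`). -/
theorem cobordantTransform_X_cube [Nontrivial K] :
    cobordantTransform (fun _ : Fin 1 => 1) 2 (X 0 ^ 3 : MvPolynomial (Fin 1) K) =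
      X (some 0) ^ 3 * X none := by
  rw [X_pow_eq_monomial, cobordantTransform_monomial _ _ _ one_ne_zero, cobordantExponent_single,
    X_pow_eq_monomial, X, monomial_mul]
  norm_num

/-- The residual polynomial of `0` is `0`. -/
theorem residual_zero (w : σ → ℕ) (ℓ : ℕ) (b : Option σ → K) :
    residual w ℓ b (0 : MvPolynomial σ K) = 0 := by
  simp [residual, pointPolynomial, cobordantTransform_zero, PointBlowup.translate]

/-- The residual polynomial VANISHES AT THE POINT: its constant coefficient is `0` (it is
`F'(s, u'+b) − F'(0, b)`), so `IsEquimultiplePoint` (`ord₀ residual ≥ q`) measures a genuine germ. -/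
theorem constantCoeff_residual (w : σ → ℕ) (ℓ : ℕ) (b : Option σ → K) (F : MvPolynomial σ K) :
    constantCoeff (residual w ℓ b F) = 0 := by
  simp [residual]

end Summit.ResolutionOfSingularities.KangarooAtlas.Runbook
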